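import Mathlib
import Summits.ValiantsHypothesis.ValiantsHypothesis.Theorems.KPlusLogSqLawTropicalBExchangeSquare
import Summits.ValiantsHypothesis.ValiantsHypothesis.Theorems.LacunarySymmetroidMatrixDescartesCensusTropicalKLawSlopes

/-!
# `TropicalB` (stmt-ValiantsHypothesis-19771) — NO REPEATED EXCHANGE: the dominant terms of a design form a Sidon family

Helper file for the crux `Theses.KPlusLogSqLaw.TropicalB` (`--supports stmt-ValiantsHypothesis-19771 --as helper`), cell
`pub-symmetroid`, seat val-sym-trop-p5 (g7, refuter-adjacent lane).  HONEST FRAMING: a structure law about the dominant terms of an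
ARBITRARY tropical design `(d, v, ε)` in the tree's vocabulary (`IsDominant`, `tropWeight`, `termSign` of
`…MatrixDescartesFalseOfTropicalMonster`); nothing here bears on `TropicalB` in its window, `WeakLifting`, `MatrixDescartes`
(stmt-ValiantsHypothesis-18050) or VP ≠ VNP.

* `weightDiff_ne` — **SIDON LAW.**  Let `p : ι → terms` be an injective family of terms, each dominant at some integer slope.  Then for
  two different ordered pairs `(s, s') ≠ (t, t')` of distinct indices the EXCHANGES differ: the affine functions
  `θ ↦ w_θ(p s') − w_θ(p s)` and `θ ↦ w_θ(p t') − w_θ(p t)` are not identical.  Equivalently the points `(slope, valuation)` of the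
  dominant terms of any design form a Sidon set of the plane (all pairwise sums distinct).  For four pairwise distinct indices this is
  the tree's EXCHANGE-SQUARE LAW `ExchangeSquare.not_dominant_square` (p493290); the cases with a shared index are two-line dominance
  comparisons.  This is the kernel form of the «repeated-exchange obstruction» met by every K = 4 odometer architecture tested by LP in
  the cell (val-sym-lift-p1 g5 K2; val-sym-trop-p5 g7 census): a candidate family of dominant terms in which two different pairs of
  members differ by the same signed set of cells is dead, whatever the costs.
* `chain_weightDiff_ne` — the same for the terms of a dominant sign-alternating chain (the hypotheses of `TropRow` / `TropRootLawAt`: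
  the chain is injective because slopes strictly increase, `TropicalCensus.slope_lt_of_dominant`).
* `consecutive_exchange_ne` — in particular the `n` consecutive exchanges of a chain with `n` sign changes are pairwise distinct.
[folklore-level: strict convexity of the upper envelope; the four-point case is p493290]
-/

set_option linter.dupNamespace false
set_option autoImplicit false

namespace Summit.ValiantsHypothesis.ValiantsHypothesis.Theorems.KPlusLogSqLaw.NoRepeatedExchange

open Summit.ValiantsHypothesis.ValiantsHypothesis.Theorems.MatrixDescartes.Negative

variable {m K : ℕ} (d : Fin K → ℕ) (v ε : Fin m → Fin m → Fin K → ℤ)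

/-- **SIDON LAW (no repeated exchange)**: in an injective family of dominant terms, two different ordered pairs of distinct members
never have the same weight difference as a function of the slope parameter. -/
theorem weightDiff_ne {ι : Type*} {p : ι → Equiv.Perm (Fin m) × (Fin m → Fin K)} {θ : ι → ℤ}
    (hdom : ∀ a, IsDominant d v ε (θ a) (p a)) (hinj : Function.Injective p)
    {s s' t t' : ι} (hs : s ≠ s') (ht : t ≠ t') (hne : (s, s') ≠ (t, t')) :
    ¬ ∀ θ₀ : ℤ, tropWeight d v θ₀ (p s') - tropWeight d v θ₀ (p s) =
        tropWeight d v θ₀ (p t') - tropWeight d v θ₀ (p t) := by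
  intro heq
  -- a dominant member beats every other member at its own slope
  have beat : ∀ {a b : ι}, a ≠ b → tropWeight d v (θ a) (p b) < tropWeight d v (θ a) (p a) :=
    fun {a b} hab => (hdom a).2 (p b) (fun h => hab (hinj h).symm) (hdom b).1
  by_cases h1 : s = t
  · subst h1
    have hst : s' ≠ t' := fun h => hne (by rw [h])
    have e := heq (θ s')
    have hb := beat hst
    linarith
  by_cases h2 : s' = t'
  · subst h2
    have e := heq (θ s)
    have hb := beat h1
    linarith
  by_cases h3 : s = t'
  · subst h3
    by_cases h4 : s' = t
    · subst h4
      have e := heq (θ s)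
      have hb := beat hs
      linarith
    · have e := heq (θ s)
      have hb1 := beat hs
      have hb2 := beat (Ne.symm ht)
      linarith
  by_cases h4 : s' = t
  · subst h4
    have e := heq (θ s')
    have hb1 := beat (Ne.symm hs)
    have hb2 := beat h2
    linarith
  -- four pairwise distinct indices: the exchange-square law
  exact ExchangeSquare.not_dominant_square d v ε (hinj.ne hs) (hinj.ne h1) (hinj.ne (fun h => h2 h.symm))
    (hinj.ne (Ne.symm ht)) (fun θ₀ => by have e := heq θ₀; linarith) (hdom s) (hdom s') (hdom t) (hdom t')

/-- the terms of a dominant sign-alternating chain are pairwise distinct (slopes strictly increase). -/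
theorem chain_injective {n : ℕ} {θ : Fin (n + 1) → ℤ} {p : Fin (n + 1) → Equiv.Perm (Fin m) × (Fin m → Fin K)}
    (hθ : StrictMono θ) (hdom : ∀ k, IsDominant d v ε (θ k) (p k))
    (halt : ∀ k : Fin n, termSign ε (p k.castSucc) * termSign ε (p k.succ) < 0) :
    Function.Injective p := by
  have hne : ∀ k : Fin n, p k.castSucc ≠ p k.succ := by
    intro k h
    have := halt k
    rw [h] at this
    exact absurd this (not_lt.mpr (mul_self_nonneg _))
  have hsm : StrictMono fun k =>
      Summit.ValiantsHypothesis.ValiantsHypothesis.Theorems.LacunarySymmetroidMatrixDescartes.TropicalCensus.slope d (p k) := by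
    rw [Fin.strictMono_iff_lt_succ]
    intro k
    exact Summit.ValiantsHypothesis.ValiantsHypothesis.Theorems.LacunarySymmetroidMatrixDescartes.TropicalCensus.slope_lt_of_dominant
      d v ε (hθ (Fin.castSucc_lt_succ)) (hne k) (hdom _) (hdom _)
  intro a b hab
  apply hsm.injective
  simp only [hab]

/-- **chain form**: along a dominant sign-alternating chain (the hypotheses of `TropRow`), two different ordered pairs of distinct
positions never have the same weight difference (same exchange). -/
theorem chain_weightDiff_ne {n : ℕ} {θ : Fin (n + 1) → ℤ} {p : Fin (n + 1) → Equiv.Perm (Fin m) × (Fin m → Fin K)}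
    (hθ : StrictMono θ) (hdom : ∀ k, IsDominant d v ε (θ k) (p k))
    (halt : ∀ k : Fin n, termSign ε (p k.castSucc) * termSign ε (p k.succ) < 0)
    {s s' t t' : Fin (n + 1)} (hs : s ≠ s') (ht : t ≠ t') (hne : (s, s') ≠ (t, t')) :
    ¬ ∀ θ₀ : ℤ, tropWeight d v θ₀ (p s') - tropWeight d v θ₀ (p s) =
        tropWeight d v θ₀ (p t') - tropWeight d v θ₀ (p t) :=
  weightDiff_ne d v ε hdom (chain_injective d v ε hθ hdom halt) hs ht hne

/-- **consecutive exchanges are pairwise distinct** along a dominant sign-alternating chain. -/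
theorem consecutive_exchange_ne {n : ℕ} {θ : Fin (n + 1) → ℤ} {p : Fin (n + 1) → Equiv.Perm (Fin m) × (Fin m → Fin K)}
    (hθ : StrictMono θ) (hdom : ∀ k, IsDominant d v ε (θ k) (p k))
    (halt : ∀ k : Fin n, termSign ε (p k.castSucc) * termSign ε (p k.succ) < 0)
    {s t : Fin n} (hst : s ≠ t) :
    ¬ ∀ θ₀ : ℤ, tropWeight d v θ₀ (p s.succ) - tropWeight d v θ₀ (p s.castSucc) =
        tropWeight d v θ₀ (p t.succ) - tropWeight d v θ₀ (p t.castSucc) :=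
  chain_weightDiff_ne d v ε hθ hdom halt (Fin.castSucc_lt_succ).ne (Fin.castSucc_lt_succ).ne
    (fun h => hst (Fin.castSucc_injective _ (Prod.mk.inj h).1))

/-! ### Appendix (same seat, same day): the CELL form of the Sidon law
The weight of a term is linear in its cell indicator `[(σ i, i, λ i) = (a, i, l)]`, so «same signed set of cells exchanged» implies
«same weight difference»; hence two different ordered pairs of distinct dominant terms never differ by the same signed set of cells.
This is the form in which the law is used against candidate families (a flip available at two chain states in opposite directions). -/

/-- the tropical weight as a sum over CELLS `(a, i, l)` (row, column, class) weighted by the term's cell indicator. -/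
theorem tropWeight_eq_sum_cells (θ : ℤ) (p : Equiv.Perm (Fin m) × (Fin m → Fin K)) :
    tropWeight d v θ p = ∑ i, ∑ a, ∑ l, (if p.1 i = a ∧ p.2 i = l then (1 : ℤ) else 0) * (θ * d l - v a i l) := by
  unfold tropWeight
  rw [Finset.mul_sum, ← Finset.sum_sub_distrib]
  refine Finset.sum_congr rfl fun i _ => ?_
  simp only [ite_and]
  rw [Finset.sum_comm]
  simp [Finset.sum_ite_eq, Finset.mem_univ]

/-- equal CELL differences give equal weight differences (the weight is linear in the cell indicator). -/
theorem weightDiff_eq_of_cells {p p' q q' : Equiv.Perm (Fin m) × (Fin m → Fin K)}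
    (h : ∀ (a i : Fin m) (l : Fin K),
      (if p'.1 i = a ∧ p'.2 i = l then (1 : ℤ) else 0) - (if p.1 i = a ∧ p.2 i = l then (1 : ℤ) else 0) =
      (if q'.1 i = a ∧ q'.2 i = l then (1 : ℤ) else 0) - (if q.1 i = a ∧ q.2 i = l then (1 : ℤ) else 0)) (θ : ℤ) :
    tropWeight d v θ p' - tropWeight d v θ p = tropWeight d v θ q' - tropWeight d v θ q := by
  simp only [tropWeight_eq_sum_cells, ← Finset.sum_sub_distrib, ← sub_mul]
  refine Finset.sum_congr rfl fun i _ => Finset.sum_congr rfl fun a _ => Finset.sum_congr rfl fun l _ => ?_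
  rw [h a i l]

/-- **SIDON LAW, cell form**: in an injective family of dominant terms of any design, two different ordered pairs of distinct members
never differ by the same signed set of cells `(row, column, class)`. -/
theorem cellDiff_ne {ι : Type*} {p : ι → Equiv.Perm (Fin m) × (Fin m → Fin K)} {θ : ι → ℤ}
    (hdom : ∀ a, IsDominant d v ε (θ a) (p a)) (hinj : Function.Injective p)
    {s s' t t' : ι} (hs : s ≠ s') (ht : t ≠ t') (hne : (s, s') ≠ (t, t')) :
    ¬ ∀ (a i : Fin m) (l : Fin K),
      (if (p s').1 i = a ∧ (p s').2 i = l then (1 : ℤ) else 0) - (if (p s).1 i = a ∧ (p s).2 i = l then (1 : ℤ) else 0) =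
      (if (p t').1 i = a ∧ (p t').2 i = l then (1 : ℤ) else 0) - (if (p t).1 i = a ∧ (p t).2 i = l then (1 : ℤ) else 0) :=
  fun h => weightDiff_ne d v ε hdom hinj hs ht hne (weightDiff_eq_of_cells d v h)

/-- **cell form along a chain**: along a dominant sign-alternating chain (the hypotheses of `TropRow`), two different ordered pairs of
distinct positions never differ by the same signed set of cells. -/
theorem chain_cellDiff_ne {n : ℕ} {θ : Fin (n + 1) → ℤ} {p : Fin (n + 1) → Equiv.Perm (Fin m) × (Fin m → Fin K)}
    (hθ : StrictMono θ) (hdom : ∀ k, IsDominant d v ε (θ k) (p k))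
    (halt : ∀ k : Fin n, termSign ε (p k.castSucc) * termSign ε (p k.succ) < 0)
    {s s' t t' : Fin (n + 1)} (hs : s ≠ s') (ht : t ≠ t') (hne : (s, s') ≠ (t, t')) :
    ¬ ∀ (a i : Fin m) (l : Fin K),
      (if (p s').1 i = a ∧ (p s').2 i = l then (1 : ℤ) else 0) - (if (p s).1 i = a ∧ (p s).2 i = l then (1 : ℤ) else 0) =
      (if (p t').1 i = a ∧ (p t').2 i = l then (1 : ℤ) else 0) - (if (p t).1 i = a ∧ (p t).2 i = l then (1 : ℤ) else 0) :=
  cellDiff_ne d v ε hdom (chain_injective d v ε hθ hdom halt) hs ht hne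

end Summit.ValiantsHypothesis.ValiantsHypothesis.Theorems.KPlusLogSqLaw.NoRepeatedExchange
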